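import Summits.QuantumFields.QCD.Theses.GapBuysCauchyRate
import Literature.MathematicalPhysics.QuantumFieldTheory.GaugeCovariantBlockMap
import Literature.MathematicalPhysics.QuantumFieldTheory.QCDTorusTranslation
import Literature.MathematicalPhysics.QuantumFieldTheory.QCDPhaseQuenchedReweighting

/-!
# Stub `stub_onePointTranslation` of line `birth` for crux `GapBuysCauchyRate.LadderCauchyRate`
(item stmt-QuantumFields-17307, route route-QuantumFields-GapBuysCauchyRate, sub-problem QCD)

What is proved: for every flavour number `N_f`, every torus of odd side `2S+1`, every `β` and all
bare masses, (1) the torus one-point expectations `⟨insertion s x⟩_{β,2S+1,m}` of every species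
field `s` (glue, `pseudoRe f g`, `pseudoIm f g`) do not depend on the site `x ∈ ℤ⁴`, and (2) the
`glue` one-point expectation is real.

How. (1) Translation covariance of the honest signed functional
(`qcdTorusExpect_quarkTranslate`: `⟨u · X(τ_{−u} ·)⟩ = ⟨X⟩`) applied to `X U = insertion U s 0`
and `u = x mod (2S+1)`, together with the pointwise identity
`u · insertion (τ_{−u} U) s 0 = insertion U s x`: for `glue` the quark translation fixes scalars
(`AlgHom.commutes`) and the periodic lift intertwines the translations (`configShift_torusLift`);
for the pseudoscalar species `quarkTranslate_qbar/_q` move the bilinear `P_{fg}(0)` to `P_{fg}(u)`.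
(2) `∫dψ̄dψ (c · 1) e^{−ψ̄Dψ} = c · ε det D` (`fermiIntegral_fermiBoltzmann`, `ε` the orientation
sign) with `c` the real action density and `det D` real (`det_diracMatrix_eq_ofReal_re`); the sign
`ε` cancels in the quotient, which is then a quotient of integrals of real functions
(`integral_complex_ofReal`).  Sources: Montvay–Münster 1994 §4.1 (4.17), (4.21), §5.1, (5.16);
Osterwalder–Seiler 1978 §2.

Pure theorem file (no definitions): the registered stub signature, proved in tree vocabulary.
-/

noncomputable section

namespace Summit.QuantumFields.QCD.Cruxes.LadderCauchyRate.Birth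

open scoped BigOperators Topology Classical
open MeasureTheory Filter
open Literature.MathematicalPhysics.AQFT Literature.Probability.LatticeModels
  Literature.MathematicalPhysics.QuantumLattice Literature.MathematicalPhysics.QuantumFieldTheory
open Summit.QuantumFields.QCD.Theses.GapBuysCauchyRate

/-- The quark translation moves the local pseudoscalar bilinear: `u · P_{fg}(y) = P_{fg}(y + u)`. -/
private theorem quarkTranslate_pseudoscalarBilinear {Nf L : ℕ} [NeZero L] (u : TorusSite 4 L)
    (f g : Fin Nf) (y : TorusSite 4 L) :
    quarkTranslate Nf u (pseudoscalarBilinear f g y) = pseudoscalarBilinear f g (y + u) := by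
  simp only [pseudoscalarBilinear, map_sum, map_smul, map_mul, quarkTranslate_qbar, quarkTranslate_q]

/-- The origin of `ℤ⁴` projects to the origin of the torus. -/
private theorem torusProj_zero (L : ℕ) :
    Torus.proj L (0 : _root_.Literature.Probability.LatticeModels.Site 4) = 0 := by
  funext i
  simp only [Torus.proj_apply, Pi.zero_apply, Int.cast_zero]

/-- The zero translation of `ℤ⁴`-gauge configurations is the identity. -/
private theorem configShift_zero_eq {G : Type*} [MeasurableSpace G] (U : LGConfig 4 G) :
    Literature.MathematicalPhysics.QuantumLattice.configShift
      (0 : _root_.Literature.Probability.LatticeModels.Site 4) U = U := by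
  funext e
  simp only [Literature.MathematicalPhysics.QuantumLattice.configShift_apply, sub_zero, Prod.mk.eta]

/-- **Placing a species field at `x` is translating its placement at the origin**:
`insertion U s x = u · insertion (τ_{−u} U) s 0` with `u = x mod L`. -/
private theorem quarkTranslate_insertion_zero {Nf L : ℕ} [NeZero L] (s : QCDField Nf)
    (x : _root_.Literature.Probability.LatticeModels.Site 4) (U : GaugeConfig 4 L SU3) :
    quarkTranslate Nf (Torus.proj L x) (insertion (torusConfigShift (-Torus.proj L x) U) s 0) =
      insertion U s x := by
  cases s with
  | glue =>
    simp only [insertion]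
    rw [AlgHom.commutes, neg_zero, configShift_zero_eq, configShift_torusLift, torusProj_neg']
  | pseudoRe f g =>
    simp only [insertion, map_smul, map_add, quarkTranslate_pseudoscalarBilinear, torusProj_zero,
      zero_add]
  | pseudoIm f g =>
    simp only [insertion, map_smul, map_sub, quarkTranslate_pseudoscalarBilinear, torusProj_zero,
      zero_add]

/-- **The Berezin integral of the `glue` insertion against the Boltzmann factor is `ε` times a real
number**: `∫dψ̄dψ (c · 1) e^{−ψ̄Dψ} = ε · (c · Re det D)` (`c` the real action density, `det D` real). -/
private theorem fermiIntegral_glue_mul_fermiBoltzmann {Nf L : ℕ} [NeZero L]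
    (U : GaugeConfig 4 L SU3) (mq : Fin Nf → ℝ) :
    fermiIntegral (insertion U (QCDField.glue : QCDField Nf) 0 * fermiBoltzmann U mq) =
      (-1 : ℂ) ^ (Fintype.card (FermiIdx Nf L) * (Fintype.card (FermiIdx Nf L) - 1) / 2 +
          Fintype.card (FermiIdx Nf L)) *
        ((actionDensity (fundamentalRep (Fin 3))
            (Literature.MathematicalPhysics.QuantumLattice.configShift
              (-(0 : _root_.Literature.Probability.LatticeModels.Site 4)) (torusLift L U)) *
            ((diracMatrix U mq).det).re : ℝ) : ℂ) := by
  simp only [insertion]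
  rw [← Algebra.smul_def, map_smul, smul_eq_mul, fermiIntegral_fermiBoltzmann, Complex.ofReal_mul,
    ← det_diracMatrix_eq_ofReal_re]
  ring

/-- **The fermionic partition function in a background is `ε` times a real number**:
`∫dψ̄dψ e^{−ψ̄Dψ} = ε · Re det D`. -/
private theorem fermiIntegral_fermiBoltzmann_ofReal {Nf L : ℕ} [NeZero L]
    (U : GaugeConfig 4 L SU3) (mq : Fin Nf → ℝ) :
    fermiIntegral (fermiBoltzmann U mq) =
      (-1 : ℂ) ^ (Fintype.card (FermiIdx Nf L) * (Fintype.card (FermiIdx Nf L) - 1) / 2 +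
          Fintype.card (FermiIdx Nf L)) * ((((diracMatrix U mq).det).re : ℝ) : ℂ) := by
  rw [fermiIntegral_fermiBoltzmann, ← det_diracMatrix_eq_ofReal_re]

/-- (T) **site-independence of the one-point torus expectations, and reality of the `glue` one**
(size M, provable now: `qcdTorusExpect_quarkTranslate`; `fermiIntegral_fermiBoltzmann`,
`det_diracMatrix_im`).  Registered in tree vocabulary. -/
theorem stub_onePointTranslation :
    ∀ (Nf S : ℕ) (β : ℝ) (mq : Fin Nf → ℝ),
      (∀ (s : QCDField Nf) (x : Literature.Probability.LatticeModels.Site 4),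
        qcdTorusExpect β (2 * S + 1) mq (fun U => insertion U s x) =
          qcdTorusExpect β (2 * S + 1) mq (fun U => insertion U s 0)) ∧
      (qcdTorusExpect β (2 * S + 1) mq (fun U => insertion U (QCDField.glue : QCDField Nf) 0)).im = 0 := by
  intro Nf S β mq
  refine ⟨fun s x => ?_, ?_⟩
  · -- (1) translation covariance of the honest functional + the pointwise placement identity
    have h := qcdTorusExpect_quarkTranslate β mq (Torus.proj (2 * S + 1) x) (fun U => insertion U s 0)
    simp only [quarkTranslate_insertion_zero] at h
    exact h
  · -- (2) the orientation sign cancels; numerator and denominator are integrals of real functions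
    have hε := fermiOrientationSign_ne_zero
      (Fintype.card (FermiIdx Nf (2 * S + 1)) * (Fintype.card (FermiIdx Nf (2 * S + 1)) - 1) / 2 +
        Fintype.card (FermiIdx Nf (2 * S + 1)))
    unfold qcdTorusExpect
    simp only [fermiIntegral_glue_mul_fermiBoltzmann, fermiIntegral_fermiBoltzmann_ofReal]
    rw [integral_const_mul, integral_const_mul, mul_div_mul_left _ _ hε, integral_complex_ofReal,
      integral_complex_ofReal, ← Complex.ofReal_div, Complex.ofReal_im]

end Summit.QuantumFields.QCD.Cruxes.LadderCauchyRate.Birth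

end
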